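import Mathlib

/-!
# PercRepro — a weighted Chebyshev inequality and the binomial moment sums (night-2, NIGHT-2-t3.md §7 (3))

Two pieces of pure arithmetic for the `q`-free criterion of the type-`3` layer.
* `weighted_chebyshev`: for positive weights `T`, a non-decreasing `u` and a non-increasing `f` on a finite set,
  `(Σ T u f)·(Σ T) ≤ (Σ T u)·(Σ T f)` (Chebyshev's sum inequality with weights).
* `ratio_profile_bound`: if `i_{k+1}·T_k ≥ i_k·T_{k+1}` on `0 ≤ k < d` (the ratios of `i` dominate those of the
  profile `T`) and `f` is non-increasing on `0..d`, then `(Σ i f)·(Σ T) ≤ (Σ i)·(Σ T f)` — the comparison used to bound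
  the signed size sum of the coindependent sets against a binomial profile.
* `sum_range_choose_mul_self`: `Σ_{k ≤ n} k·C(n, k) = n·2^(n−1)` (as `2·Σ k·C(n,k) = n·2^n`).
Imports Mathlib only.
-/
namespace PercRepro.Star

open Finset

/-- Weighted Chebyshev: positive weights `T`, `u` non-decreasing and `f` non-increasing on `s`. -/
theorem weighted_chebyshev (s : Finset ℕ) (T u f : ℕ → ℚ) (hT : ∀ k ∈ s, 0 ≤ T k)
    (hu : ∀ j ∈ s, ∀ k ∈ s, j ≤ k → u j ≤ u k) (hf : ∀ j ∈ s, ∀ k ∈ s, j ≤ k → f k ≤ f j) :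
    (∑ k ∈ s, T k * u k * f k) * (∑ k ∈ s, T k) ≤ (∑ k ∈ s, T k * u k) * (∑ k ∈ s, T k * f k) := by
  -- the difference is `Σ_j Σ_k T_k T_j u_k (f_k − f_j)`; symmetrising gives `(1/2) Σ Σ T_k T_j (u_k − u_j)(f_k − f_j) ≤ 0`
  have hpair : ∀ j ∈ s, ∀ k ∈ s, (u k - u j) * (f k - f j) ≤ 0 := by
    intro j hj k hk
    rcases le_total j k with h | h
    · have h1 := hu j hj k hk h
      have h2 := hf j hj k hk h
      nlinarith
    · have h1 := hu k hk j hj h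
      have h2 := hf k hk j hj h
      nlinarith
  have key : ∑ k ∈ s, ∑ j ∈ s, T k * T j * ((u k - u j) * (f k - f j)) ≤ 0 := by
    apply Finset.sum_nonpos
    intro k hk
    apply Finset.sum_nonpos
    intro j hj
    exact mul_nonpos_of_nonneg_of_nonpos (mul_nonneg (hT k hk) (hT j hj)) (hpair j hj k hk)
  -- expand the double sum
  have expand : ∑ k ∈ s, ∑ j ∈ s, T k * T j * ((u k - u j) * (f k - f j)) =
      2 * ((∑ k ∈ s, T k * u k * f k) * (∑ k ∈ s, T k)) -
        2 * ((∑ k ∈ s, T k * u k) * (∑ k ∈ s, T k * f k)) := by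
    have e1 : ∀ k j : ℕ, T k * T j * ((u k - u j) * (f k - f j)) =
        (T k * u k * f k) * T j + (T j * u j * f j) * T k - (T k * u k) * (T j * f j) -
          (T j * u j) * (T k * f k) := by
      intro k j
      ring
    simp_rw [e1]
    simp only [Finset.sum_sub_distrib, Finset.sum_add_distrib, ← Finset.sum_mul, ← Finset.mul_sum]
    ring
  linarith

/-- **Ratio-profile comparison**: if `i_{k+1} T_k ≥ i_k T_{k+1}` for `k < d` (with `T > 0` on `0..d`) and `f` is
non-increasing on `0..d`, then `(Σ_{k ≤ d} i_k f_k)·(Σ T_k) ≤ (Σ i_k)·(Σ T_k f_k)`. -/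
theorem ratio_profile_bound (d : ℕ) (i T f : ℕ → ℚ) (hT : ∀ k ∈ Finset.range (d + 1), 0 < T k)
    (hratio : ∀ k, k < d → i k * T (k + 1) ≤ i (k + 1) * T k)
    (hf : ∀ j ∈ Finset.range (d + 1), ∀ k ∈ Finset.range (d + 1), j ≤ k → f k ≤ f j) :
    (∑ k ∈ Finset.range (d + 1), i k * f k) * (∑ k ∈ Finset.range (d + 1), T k) ≤
      (∑ k ∈ Finset.range (d + 1), i k) * (∑ k ∈ Finset.range (d + 1), T k * f k) := by
  set u : ℕ → ℚ := fun k => i k / T k with hu_def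
  have hTu : ∀ k ∈ Finset.range (d + 1), T k * u k = i k := by
    intro k hk
    simp only [hu_def]
    field_simp [(hT k hk).ne']
  -- `u` is non-decreasing on `0..d`
  have hstep : ∀ k, k < d → u k ≤ u (k + 1) := by
    intro k hk
    have hk1 : k ∈ Finset.range (d + 1) := Finset.mem_range.2 (by omega)
    have hk2 : k + 1 ∈ Finset.range (d + 1) := Finset.mem_range.2 (by omega)
    have h1 := hT k hk1
    have h2 := hT (k + 1) hk2
    simp only [hu_def]
    rw [div_le_div_iff₀ h1 h2]
    linarith [hratio k hk]
  have hmono : ∀ j ∈ Finset.range (d + 1), ∀ k ∈ Finset.range (d + 1), j ≤ k → u j ≤ u k := by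
    intro j hj k hk hjk
    have hk' := Finset.mem_range.1 hk
    induction k, hjk using Nat.le_induction with
    | base => exact le_rfl
    | succ m hjm ih =>
      have hm : m ∈ Finset.range (d + 1) := Finset.mem_range.2 (by omega)
      exact (ih hm (by omega)).trans (hstep m (by omega))
  have hTnn : ∀ k ∈ Finset.range (d + 1), 0 ≤ T k := fun k hk => (hT k hk).le
  have := weighted_chebyshev (Finset.range (d + 1)) T u f hTnn hmono hf
  have e1 : ∑ k ∈ Finset.range (d + 1), T k * u k * f k = ∑ k ∈ Finset.range (d + 1), i k * f k := by
    apply Finset.sum_congr rfl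
    intro k hk
    rw [hTu k hk]
  have e2 : ∑ k ∈ Finset.range (d + 1), T k * u k = ∑ k ∈ Finset.range (d + 1), i k := by
    apply Finset.sum_congr rfl
    intro k hk
    rw [hTu k hk]
  rwa [e1, e2] at this

/-- `2·Σ_{k ≤ n} k·C(n, k) = n·2^n`. -/
theorem two_mul_sum_range_choose_mul (n : ℕ) :
    2 * ∑ k ∈ Finset.range (n + 1), ((k : ℚ) * (n.choose k : ℚ)) = (n : ℚ) * 2 ^ n := by
  induction n with
  | zero => simp
  | succ n ih =>
    -- `Σ_{k ≤ n+1} k C(n+1,k) = Σ_{j ≤ n} (j+1) C(n+1, j+1) = (n+1) Σ_j C(n, j) = (n+1) 2^n`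
    have h : ∑ k ∈ Finset.range (n + 2), ((k : ℚ) * ((n + 1).choose k : ℚ)) =
        ((n : ℚ) + 1) * ∑ j ∈ Finset.range (n + 1), (n.choose j : ℚ) := by
      rw [Finset.sum_range_succ', Finset.mul_sum]
      simp only [Nat.cast_zero, zero_mul, add_zero]
      apply Finset.sum_congr rfl
      intro j _
      have := Nat.add_one_mul_choose_eq n j
      have h' : ((n : ℚ) + 1) * (n.choose j : ℚ) = ((n + 1).choose (j + 1) : ℚ) * ((j : ℚ) + 1) := by
        exact_mod_cast this
      push_cast
      linarith [h']
    rw [h]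
    have hs : ∑ j ∈ Finset.range (n + 1), (n.choose j : ℚ) = 2 ^ n := by
      exact_mod_cast Nat.sum_range_choose n
    rw [hs]
    push_cast
    ring

/-- `Σ_{k ≤ n} C(n, k)·(a − 2k) = (a − n)·2^n` for every rational `a`. -/
theorem sum_range_choose_mul_sub (n : ℕ) (a : ℚ) :
    ∑ k ∈ Finset.range (n + 1), (n.choose k : ℚ) * (a - 2 * (k : ℚ)) = (a - (n : ℚ)) * 2 ^ n := by
  have h1 : ∑ k ∈ Finset.range (n + 1), (n.choose k : ℚ) * (a - 2 * (k : ℚ)) =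
      a * ∑ k ∈ Finset.range (n + 1), (n.choose k : ℚ) -
        2 * ∑ k ∈ Finset.range (n + 1), ((k : ℚ) * (n.choose k : ℚ)) := by
    rw [Finset.mul_sum, Finset.mul_sum, ← Finset.sum_sub_distrib]
    apply Finset.sum_congr rfl
    intro k _
    ring
  rw [h1, two_mul_sum_range_choose_mul]
  have hs : ∑ j ∈ Finset.range (n + 1), (n.choose j : ℚ) = 2 ^ n := by
    exact_mod_cast Nat.sum_range_choose n
  rw [hs]
  ring

end PercRepro.Star
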